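import Summits.BirchSwinnertonDyer.BirchSwinnertonDyer.Theorems.SignedLowerHalvesSmallImageMuZeroOneSignFinePivot
import HarnessLib

/-!
# Route `SignedLowerHalves` (K3), crux M `SmallImageMuZeroOneSign` (item stmt-BirchSwinnertonDyer-23600), line `birth_mu` —
# the FINE PIVOT, part 4: ONE sign for all cyclotomic data; crux M BY NAME from Conjecture A on its domain; the converse

LEAD seat `cruxlead-stmt-BirchSwinnertonDyer-23600` gen 2 (cell `bsd-ssimc`; `--supports stmt-BirchSwinnertonDyer-23600`).  HONEST FRAMING:
CONDITIONAL theorems; binders displayed, never discharged: the two Kurihara–Pollack named facts of part 3 (`hKP`, `hKo`), the tree's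
Matar 2020 / Wingberg fact (`hMa`), Coates–Sujatha's CONJECTURE A on the crux's domain (`Rank1Residual.ConjAAt W p`, OPEN) and — for the
`p = 3` rows of the mixed closer only — the five printed binders of line `birth_mu` (`hCK h12 h5 h3 hmodP`).  Crux M, crux 4 and BSD
are NOT proved by this file; Conjecture A is asserted for no curve.

## Contents
* `mu_eq_zero_of_finite_signed_pTorsion` — `Sel^ε[p]` finite ⟹ `μ(ξ) = 0` for every dual datum of sign `ε` (`char X^ε = (ξ)`).
* `oneSignMuZero_of_finite_fine_pTorsion`, `oneSignMuZero_of_conjAAt` — **M's body at the pair ⟸ Conjecture A at the pair**: the sign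
  is read off at ONE cyclotomic datum by the lever (part 3) and moved by `Kobayashi2003.exists_addEquiv_signedSelmerInfty_of_isCyclotomic`.
* `smallImageMuZeroOneSign_of_facts_of_conjA` — crux M BY NAME ⟸ the 3 prints ∧ Conjecture A on the domain (every odd `p`; no `L_p`).
* `smallImageMuZeroOneSign_of_facts_of_conjA_ge_five` — crux M BY NAME with the `p = 3` rows by the lead's landed
  `SmallImageMuControl.smallImageMuZeroOneSign_three_of_facts` (print alone) and the `p ≥ 5` rows by Conjecture A = the composition of
  line `birth_mu` v3 (stubs: `stub_printedInputsMu_ns` HELD, `stub_printedInputsFine_ns` HELD, `stub_conjA_ns_ge5` OPEN).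
* `fineMuZeroAt_of_oneSignMuZero` — the converse modulo Kobayashi Thm. 1.2: M's body at a pair ⟹ `FineMuZeroAt W p`.
READING FOR THE PEN (D-0014; numbers): modulo print, **M ⟺ Conjecture A (μ-form) on the small-image supersingular X7 class** —
strictly weaker than retired 23117 (the one-signed ANALYTIC `μ`, which implies Conjecture A at the pair through lane B's primitive
Kato class, `CoreAssembly.coreOdd_anyReduction_holds`), sign-free, `L`-function-free, image-free; the same equivalence for the ANALYTIC
`μ` holds under Kato's main conjecture (Lei–Sujatha 2021 Thm. 1.2).

References: [CoatesSujatha2005] §3 Conjecture A; [KuriharaPollack2007] §1.2, §3 p. 328; [Matar2020] Thm. 1.1; [Wingberg1989] Cor. 2.5;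
[Kobayashi2003] Def. 1.1, Thm. 1.2, (7.21), p. 35; [PollackWeston2011] Rem. 4.2; [LeiSujatha2021] Thm. 1.2; [Washington1997] §13.2.
-/

set_option autoImplicit false
set_option linter.dupNamespace false

noncomputable section

open scoped Classical MatrixGroups ModularForm

namespace Summit.BirchSwinnertonDyer.BirchSwinnertonDyer.Theorems.SmallImageFinePivot

open Literature.NumberTheory.EllipticCurves Literature.NumberTheory.EllipticCurves.Module
  Literature.NumberTheory.EllipticCurves.IwasawaAlgebra Literature.NumberTheory.EllipticCurves.IwasawaDual

section Assembly

open CongruenceSubgroup WeierstrassCurve Literature.NumberTheory.EllipticCurves.Kobayashi2003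
  Literature.NumberTheory.EllipticCurves.Rank1Residual Literature.NumberTheory.EllipticCurves.ModularForms
  ZpExtension Summit.BirchSwinnertonDyer.Rank1Residual.X1.MuLambda
  Summit.BirchSwinnertonDyer.BirchSwinnertonDyer.Theorems.SmallImageMuControl

variable {p : ℕ} [Fact p.Prime]

/-- The characteristic ideal of any module over a domain is nonzero. [folklore] -/
private theorem charIdeal_ne_bot' (M : Type*) [AddCommGroup M] [Module (IwasawaAlgebra p) M] :
    charIdeal (IwasawaAlgebra p) M ≠ ⊥ := by
  unfold charIdeal
  refine finprod_mem_induction (fun I : Ideal (IwasawaAlgebra p) ↦ I ≠ ⊥) ?_ (fun I J hI hJ ↦ ?_) ?_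
  · rw [Ideal.one_eq_top]
    exact top_ne_bot
  · exact fun h ↦ (Ideal.mul_eq_bot.mp h).elim hI hJ
  · intro 𝔭 h𝔭 h
    have h1 : 𝔭.asIdeal ≠ ⊥ := Ideal.ne_bot_of_height_eq_one h𝔭
    rcases Nat.eq_zero_or_pos (lengthAt (IwasawaAlgebra p) M 𝔭).toNat with h0 | hpos
    · rw [h0, pow_zero, Ideal.one_eq_top] at h
      exact top_ne_bot h
    · exact h1 ((Ideal.pow_eq_bot hpos.ne').mp h)

/-- **`μ(ξ) = 0` for a dual datum whose Selmer group has finite `p`-torsion**: `Sel^ε[p]` finite ⟹ `X^ε/(p)` finite ⟹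
`X^ε` is `Λ`-torsion and finitely generated over `ℤ_p` ⟹ `ℓ_{(p)}(X^ε) = 0` ⟹ `μ(ξ) = 0` for `char X^ε = (ξ)`.
[cite: Washington1997, §13.2] [cite: Kobayashi2003, Def. 1.1, Thm. 1.2] -/
theorem mu_eq_zero_of_finite_signed_pTorsion {W : WeierstrassCurve ℚ} [W.IsElliptic] {κ : ZpExtension ℚ p}
    {γ : Field.absoluteGaloisGroup ℚ} (hγ : κ.IsTopGenerator γ) {ε : ℤˣ}
    (hfin : Set.Finite {s : signedSelmerInfty W κ ε | p • s = 0}) (D : SignedSelmerDualData W κ γ ε)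
    (ξ : IwasawaAlgebra p) (hξ : D.charIdeal = Ideal.span {ξ}) : mu ξ = 0 := by
  let 𝔭 : PrimeSpectrum (IwasawaAlgebra p) := ⟨augIdealP p, isPrime_augIdealP_holds p⟩
  haveI : Module.Finite (IwasawaAlgebra p) D.X := D.moduleFinite hγ
  have hQ := finite_quot_augIdealP_of_finite_pTorsion (D.isDualPair hγ) hfin
  have hT := IwasawaModuleFinitePadicInt.isTorsion_of_finite_quotient_augIdealP p D.X hQ
  have hfg := IwasawaModuleFinitePadicInt.moduleFinite_padicInt_of_finite_quotient_augIdealP p D.X hQ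
  letI : Module ℤ_[p] D.X := Module.compHom D.X (algebraMap ℤ_[p] (IwasawaAlgebra p))
  haveI : IsScalarTower ℤ_[p] (IwasawaAlgebra p) D.X := IsScalarTower.of_compHom ℤ_[p] _ D.X
  haveI : Module.Finite ℤ_[p] D.X := hfg
  exact mu_eq_zero_of_charIdeal_eq_span_of_lengthAt_eq_zero D.X hT hξ 𝔭 rfl
    (lengthAt_eq_zero_of_finite p D.X 𝔭 rfl)

/-- **ONE SIGN FOR ALL CYCLOTOMIC DATA — the body of crux M at the pair from Conjecture A at the pair.**
For `E/ℚ` (globally minimal `W`), `p` odd of good reduction with `a_p = 0`: if `Sel₀(ℚ_∞, E[p^∞])[p]` is finite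
for every cyclotomic datum `κ` (Coates–Sujatha's Conjecture A at `(E, p)`), then for SOME sign `ε` every key-`γ`
Pontryagin dual datum `D` of `Sel^ε(E/ℚ_∞)` over every cyclotomic `κ` has `μ(ξ) = 0` for every characteristic
power series `ξ`.  The sign is read off at ONE cyclotomic datum by the lever (`finite_signed_pTorsion_or`) and
moved to all of them (`exists_addEquiv_signedSelmerInfty_of_isCyclotomic`).  Binders: the two Kurihara–Pollack
statements and Matar/Wingberg; NO `p`-adic `L`-function, NO main conjecture, NO image hypothesis.
[cite: KuriharaPollack2007, §1.2, §3 p. 328] [cite: Matar2020, Thm. 1.1] [cite: CoatesSujatha2005, §3 Conjecture A] -/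
theorem oneSignMuZero_of_finite_fine_pTorsion (hKP : kuriharaPollack2007_selmerDual_extension_of_fineDual)
    (hKo : signedSelmerInf_sub_fineSelmer_of_loc)
    (hMa : matar2020_thm11_selmerDualTorsion_pseudoIso_fineSelmerDual)
    (W : WeierstrassCurve ℚ) [W.IsElliptic] [W.IsGloballyMinimal] (hp : p ≠ 2)
    (hgood : W.HasGoodReductionAtPrime p) (hap : W.frobeniusTrace p = 0)
    (hF : ∀ κ : ZpExtension ℚ p, κ.IsCyclotomic → Set.Finite {s : W.fineSelmerInfty κ | p • s = 0}) :
    ∃ ε : ℤˣ, ∀ (κ : ZpExtension ℚ p) (γ : Field.absoluteGaloisGroup ℚ), κ.IsCyclotomic → κ.IsTopGenerator γ →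
      IsCyclotomicVariable p γ → ∀ (D : SignedSelmerDualData W κ γ ε) (ξ : IwasawaAlgebra p),
        D.charIdeal = Ideal.span {ξ} → mu ξ = 0 := by
  obtain ⟨κ₀, hκ₀, -⟩ := exists_isCyclotomic_isTopGenerator_isCyclotomicVariable_holds p
  have key : ∃ ε : ℤˣ, Set.Finite {s : signedSelmerInfty W κ₀ ε | p • s = 0} := by
    rcases finite_signed_pTorsion_or hKP hKo hMa W hp hgood hap κ₀ hκ₀ (hF κ₀ hκ₀) with h | h
    exacts [⟨1, h⟩, ⟨-1, h⟩]
  obtain ⟨ε, hε⟩ := key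
  refine ⟨ε, fun κ γ hκ hγ _ D ξ hξ ↦ ?_⟩
  obtain ⟨Ψ⟩ := exists_addEquiv_signedSelmerInfty_of_isCyclotomic W hκ₀ hκ ε
  have hεκ : Set.Finite {s : signedSelmerInfty W κ ε | p • s = 0} := by
    refine (hε.preimage Ψ.injective.injOn).subset fun s hs ↦ ?_
    change p • Ψ s = 0
    rw [← map_nsmul, show p • s = 0 from hs, map_zero]
  exact mu_eq_zero_of_finite_signed_pTorsion hγ hεκ D ξ hξ

/-- **Crux M's body at the pair from `ConjAAt W p`** (the tree's node for Conjecture A at `(E, p)`: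
SOME dual fine datum over every cyclotomic `κ` is finitely generated over `ℤ_p`).
[cite: CoatesSujatha2005, §3 Conjecture A] [cite: KuriharaPollack2007, §1.2, §3] [cite: Matar2020, Thm. 1.1] -/
theorem oneSignMuZero_of_conjAAt (hKP : kuriharaPollack2007_selmerDual_extension_of_fineDual)
    (hKo : signedSelmerInf_sub_fineSelmer_of_loc)
    (hMa : matar2020_thm11_selmerDualTorsion_pseudoIso_fineSelmerDual)
    (W : WeierstrassCurve ℚ) [W.IsElliptic] [W.IsGloballyMinimal] (hp : p ≠ 2)
    (hgood : W.HasGoodReductionAtPrime p) (hap : W.frobeniusTrace p = 0) (hA : ConjAAt W p) :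
    ∃ ε : ℤˣ, ∀ (κ : ZpExtension ℚ p) (γ : Field.absoluteGaloisGroup ℚ), κ.IsCyclotomic → κ.IsTopGenerator γ →
      IsCyclotomicVariable p γ → ∀ (D : SignedSelmerDualData W κ γ ε) (ξ : IwasawaAlgebra p),
        D.charIdeal = Ideal.span {ξ} → mu ξ = 0 :=
  oneSignMuZero_of_finite_fine_pTorsion hKP hKo hMa W hp hgood hap fun κ hκ ↦ by
    obtain ⟨γ', Y, hY⟩ := hA κ hκ
    exact IwasawaModuleFinitePadicInt.finite_pTorsion_of_fineSelmerDualData_moduleFinite W κ Y hY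

/-- **CRUX M `SmallImageMuZeroOneSign` BY NAME from Conjecture A on its domain** (modulo the three printed binders;
NO `p = 3` / `p ≥ 5` split, NO `L`-function): at every small-image supersingular X7 pair, Conjecture A at the pair
gives one sign with algebraic `μ = 0`. [cite: CoatesSujatha2005, §3 Conjecture A] [cite: Kobayashi2003, p. 35]
[cite: PollackWeston2011, Rem. 4.2] -/
theorem smallImageMuZeroOneSign_of_facts_of_conjA (hKP : kuriharaPollack2007_selmerDual_extension_of_fineDual)
    (hKo : signedSelmerInf_sub_fineSelmer_of_loc)
    (hMa : matar2020_thm11_selmerDualTorsion_pseudoIso_fineSelmerDual)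
    (hA : ∀ (W : WeierstrassCurve ℚ) [W.IsElliptic] [W.IsGloballyMinimal] (p : ℕ) [Fact p.Prime],
      p ≠ 2 → ClassX7 W p → ¬ W.HasCM → W.frobeniusTrace p = 0 → ¬ Surj W p → ConjAAt W p) :
    Summit.BirchSwinnertonDyer.BirchSwinnertonDyer.Theses.SignedLowerHalves.SmallImageMuZeroOneSign := by
  intro W _ _ p _ hp hX hCM hap hs
  exact oneSignMuZero_of_conjAAt hKP hKo hMa W hp hX.1.1 hap (hA W p hp hX hCM hap hs)

/-- **CRUX M BY NAME with the `p = 3` rows settled by print alone** (the lead's landed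
`SmallImageMuControl.smallImageMuZeroOneSign_three_of_facts`, line `birth_mu`) **and the `p ≥ 5` rows by Conjecture A**
— the composition of the reshaped line `birth_mu` v3. Binders: the five printed facts of `birth_mu` (`hCK`, `h12`,
`h5`, `h3`, `hmodP`) for `p = 3`, the three of this file for `p ≥ 5`.
[cite: CoatesSujatha2005, §3 Conjecture A] [cite: Kobayashi2003, Thm. 1.2, Thm. 6.2–6.3, Thm. 7.3] -/
theorem smallImageMuZeroOneSign_of_facts_of_conjA_ge_five
    (hCK : thm62_63_73_signedColemanKato_zeta) (h12 : thm12_signedSelmerDual_finite_torsion)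
    (h5 : realPeriodRat_eq_unit_mul_plusPeriod) (h3 : realPeriodRat_eq_unit_mul_plusPeriod_three)
    (hmodP : nonempty_modularParametrizationData)
    (hKP : kuriharaPollack2007_selmerDual_extension_of_fineDual)
    (hKo : signedSelmerInf_sub_fineSelmer_of_loc)
    (hMa : matar2020_thm11_selmerDualTorsion_pseudoIso_fineSelmerDual)
    (hA5 : ∀ (W : WeierstrassCurve ℚ) [W.IsElliptic] [W.IsGloballyMinimal] (p : ℕ) [Fact p.Prime],
      5 ≤ p → ClassX7 W p → ¬ W.HasCM → W.frobeniusTrace p = 0 → ¬ Surj W p → ConjAAt W p) :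
    Summit.BirchSwinnertonDyer.BirchSwinnertonDyer.Theses.SignedLowerHalves.SmallImageMuZeroOneSign := by
  intro W _ _ p hpP hp hX hCM hap hs
  by_cases hp5 : 5 ≤ p
  · exact oneSignMuZero_of_conjAAt hKP hKo hMa W hp hX.1.1 hap (hA5 W p hp5 hX hCM hap hs)
  · have h2 := hpP.out.two_le
    have hp3 : p = 3 := by
      interval_cases p
      · exact absurd rfl hp
      · rfl
      · exact absurd hpP.out (by decide)
    exact smallImageMuZeroOneSign_three_of_facts hCK h12 h5 h3 hmodP W p hp3 hX hCM hap hs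

/-- **THE CONVERSE (modulo Kobayashi Thm. 1.2): crux M's body at a pair forces the pointwise fine `μ = 0`**
(`FineMuZeroAt W p`, the `μ`-form of Conjecture A): `X^ε ↠ X₀` (`SignedSelmerDualData.fineDual_lengthAt_le`), and
`μ(ξ) = 0` for a generator `ξ` of `char X^ε` (torsion, Thm. 1.2) is `ℓ_{(p)}(X^ε) = 0`. So on the crux's domain
M ⟺ Conjecture A (`μ`-form), modulo print. [cite: Kobayashi2003, Thm. 1.2, (7.21)] [cite: CoatesSujatha2005, §3] -/
theorem fineMuZeroAt_of_oneSignMuZero (h12 : thm12_signedSelmerDual_finite_torsion)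
    (W : WeierstrassCurve ℚ) [W.IsElliptic] [W.IsGloballyMinimal] (hp : p ≠ 2)
    (hgood : W.HasGoodReductionAtPrime p) (hap : W.frobeniusTrace p = 0)
    (hM : ∃ ε : ℤˣ, ∀ (κ : ZpExtension ℚ p) (γ : Field.absoluteGaloisGroup ℚ), κ.IsCyclotomic → κ.IsTopGenerator γ →
      IsCyclotomicVariable p γ → ∀ (D : SignedSelmerDualData W κ γ ε) (ξ : IwasawaAlgebra p),
        D.charIdeal = Ideal.span {ξ} → mu ξ = 0) :
    FineMuZeroAt W p := by
  intro κ γ hκ hγ hγ' Y _ hYt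
  obtain ⟨ε, hε⟩ := hM
  let 𝔭 : PrimeSpectrum (IwasawaAlgebra p) := ⟨augIdealP p, isPrime_augIdealP_holds p⟩
  let D := signedSelmerDualData W κ ε hγ
  obtain ⟨hDf, hDt⟩ := h12 W p hp hgood hap κ γ hκ hγ ε D
  haveI := hDf
  obtain ⟨ξ, hξ⟩ := (charIdeal_isPrincipal_holds p D.X).principal
  have hξ' : D.charIdeal = Ideal.span {ξ} := hξ
  have hξ0 : ξ ≠ 0 := by
    intro h0
    apply charIdeal_ne_bot' (p := p) D.X
    rw [show charIdeal (IwasawaAlgebra p) D.X = Ideal.span {ξ} from hξ, h0, Ideal.span_singleton_eq_bot]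
  have hμ : muInvariant p D.X = 0 := by
    rw [← Summit.BirchSwinnertonDyer.Rank1Residual.X1.MuPart.mu_generator_eq_muInvariant D.X hDt hξ0 hξ]
    exact hε κ γ hκ hγ hγ' D ξ hξ'
  have hlen : lengthAt (IwasawaAlgebra p) D.X 𝔭 = 0 := by
    have h1 := muInvariant_eq_toNat_lengthAt p D.X 𝔭 rfl
    rw [hμ] at h1
    rcases (ENat.toNat_eq_zero.mp h1.symm) with h | h
    · exact h
    · exact absurd h (lengthAt_ne_top_of_isTorsion p D.X hDt 𝔭 rfl)
  have hY : lengthAt (IwasawaAlgebra p) Y.X 𝔭 = 0 :=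
    nonpos_iff_eq_zero.mp (hlen ▸ D.fineDual_lengthAt_le hγ Y 𝔭)
  rw [muInvariant_eq_toNat_lengthAt p Y.X 𝔭 rfl, hY]
  rfl

end Assembly

end Summit.BirchSwinnertonDyer.BirchSwinnertonDyer.Theorems.SmallImageFinePivot

end
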